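import Mathlib
import Summits.ValiantsHypothesis.ValiantsHypothesis.Theses.DivisionGap

/-!
# Sketch — crux-ideate stmt-ValiantsHypothesis-15046 (PerCofactorDegreeReduction), ideator 1, round 1

First lemmas of the two idea cards, stated as `Prop`s over existing declarations (nothing proved here):

* Card A `psd-orthant-descent`: `OrthantZeros`, `PSDDescent`, `SquareDescent`, `SquarePlusSparse`,
  `NoSquarePlusMonomial`, `AMGMFaceDescent`.
* Card B `syntactic-content-stripping`: `synMultAux`/`synMult`, `GatePowerStripping`,
  `MonomialStrippingDegreeFree` (JSS22 Thm 1, degree-free), `ContentReduction` (the C′-facing corollary).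
-/

namespace Summit.ValiantsHypothesis.ValiantsHypothesis.Cruxes.PerCofactorDegreeReduction.Ideator1

open MvPolynomial Finsupp
open Literature.Computability.AlgebraicComplexity

noncomputable section

/-- Cells of the `n × n` matrix of variables. -/
abbrev Cell (n : ℕ) := Fin n × Fin n

/-- The permanent with real coefficients. -/
abbrev perR (n : ℕ) : MvPolynomial (Cell n) ℝ := perPoly (Fin n) ℝ

/-- The permanent with nonnegative coefficients (the crux's `per_n`). -/
abbrev perN (n : ℕ) : MvPolynomial (Cell n) NNReal := perPoly (Fin n) NNReal

/-- Complexification-free "realification": a monotone polynomial read with real coefficients. -/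
abbrev toR {n : ℕ} (f : MvPolynomial (Cell n) NNReal) : MvPolynomial (Cell n) ℝ :=
  MvPolynomial.map NNReal.toRealHom f

/-! ## Card A — real sign geometry of `Z_ℝ(per_n)` -/

/-- `S` is positive semidefinite as a function on `ℝ^{n×n}`. -/
def IsPSD {n : ℕ} (S : MvPolynomial (Cell n) ℝ) : Prop :=
  ∀ z : Cell n → ℝ, 0 ≤ MvPolynomial.eval z S

/-- A sign pattern `ε ∈ {±1}^{n×n}` is rank-one: `ε_ij = a_i b_j`. Exactly the patterns on whose open
orthant all permutation products `∏ ε_{π i, i}` agree, i.e. `per` has constant sign. -/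
def IsRankOneSign {n : ℕ} (ε : Cell n → ℤˣ) : Prop :=
  ∃ a b : Fin n → ℤˣ, ∀ i j : Fin n, ε (i, j) = a i * b j

/-- `z` lies in the open orthant of `ε`. -/
def InOrthant {n : ℕ} (ε : Cell n → ℤˣ) (z : Cell n → ℝ) : Prop :=
  ∀ c, 0 < ((ε c : ℤ) : ℝ) * z c

/-- L0 (orthant zeros): the real permanent vanishes somewhere in EVERY non-rank-one open orthant
(and nowhere in a rank-one one). Elementary: two permutation terms of opposite sign can each be made
dominant. Count: rank-one patterns are `2^{2n-1}` of `2^{n²}`. -/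
def OrthantZeros : Prop :=
  ∀ n : ℕ, ∀ ε : Cell n → ℤˣ, ¬ IsRankOneSign ε →
    ∃ z : Cell n → ℝ, InOrthant ε z ∧ MvPolynomial.eval z (perR n) = 0

/-- L1 (PSD descent): PSD summands of a multiple of `per_n` are multiples of `per_n²`
(a nonnegative function vanishing where `per` changes sign vanishes to second order; the smooth real
zeros are Zariski dense in the irreducible hypersurface `per_n = 0`). -/
def PSDDescent : Prop :=
  ∀ n : ℕ, 2 ≤ n → ∀ (ι : Type) [Fintype ι] (S : ι → MvPolynomial (Cell n) ℝ),
    (∀ t, IsPSD (S t)) → (perR n ∣ ∑ t, S t) → ∀ t, perR n ^ 2 ∣ S t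

/-- L1′ (squares descend, degree halves): if a sum of squares of real polynomials is a multiple of
`per_n` then every base is. This is the "unsquaring" step: `deg u_t = deg/2`. -/
def SquareDescent : Prop :=
  ∀ n : ℕ, 2 ≤ n → ∀ (ι : Type) [Fintype ι] (u : ι → MvPolynomial (Cell n) ℝ),
    (perR n ∣ ∑ t, u t ^ 2) → ∀ t, perR n ∣ u t

/-- Parity pattern of an exponent vector. -/
def parityOf {n : ℕ} (m : Cell n →₀ ℕ) : Cell n → ZMod 2 := fun c => (m c : ZMod 2)

/-- The `𝔽₂`-span of the parities of the support of `T` contains every even-margin pattern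
(`W^⊥`, dimension `(n-1)²`). If it does NOT, some non-rank-one orthant makes all monomials of `T`
positive. Automatic failure when `|supp T| < (n-1)²`. -/
def ParityRich {n : ℕ} (T : MvPolynomial (Cell n) ℝ) : Prop :=
  ∀ v : Cell n → ZMod 2, (∀ i, ∑ j, v (i, j) = 0) → (∀ j, ∑ i, v (i, j) = 0) →
    v ∈ Submodule.span (ZMod 2) (parityOf '' (T.support : Set (Cell n →₀ ℕ)))

/-- L2 (square + sparse rigidity): for `n ≥ 3`, PSD + (nonzero monotone, parity-poor) is never a
multiple of `per_n`. In particular `F² + c·x^m ∉ (per_n)` (`NoSquarePlusMonomial`): the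
HY21-Theorem-30 mechanism `p² + x^N y^N q²` is dead modulo the permanent. `n = 2` is the exact
boundary: `x₁₁x₂₂·per₂ = (x₁₁x₂₂)² + x₁₁x₁₂x₂₁x₂₂`. -/
def SquarePlusSparse : Prop :=
  ∀ n : ℕ, 3 ≤ n → ∀ (S T : MvPolynomial (Cell n) ℝ), IsPSD S →
    (∀ m, 0 ≤ T.coeff m) → T ≠ 0 → ¬ ParityRich T → ¬ (perR n ∣ S + T)

/-- L2 special case. -/
def NoSquarePlusMonomial : Prop :=
  ∀ n : ℕ, 3 ≤ n → ∀ (F : MvPolynomial (Cell n) ℝ) (m : Cell n →₀ ℕ) (c : ℝ), 0 < c →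
    ¬ (perR n ∣ F ^ 2 + monomial m c)

/-- Counting lemma behind L2: a nonzero parity-poor set misses `W^⊥`, because `|supp T| < (n-1)²`
vectors span a space of dimension `< (n-1)² = dim W^⊥`. -/
def ParityPoorOfSmallSupport : Prop :=
  ∀ n : ℕ, 3 ≤ n → ∀ T : MvPolynomial (Cell n) ℝ, T.support.card < (n - 1) ^ 2 → ¬ ParityRich T

/-- L3 (AM–GM face descent): `per | Σ A_k² + S′ + Σ x^{m_k}·A_k` with `S′` PSD forces every `A_k`
restricted to a coordinate section `{x_C = 0}` hitting all the `m_k` to be a multiple of the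
cell-deleted permanent `per_n|_{x_C = 0}` (degree halves; the permanent loses the cells `C`). -/
def AMGMFaceDescent : Prop :=
  ∀ n : ℕ, 3 ≤ n → ∀ (ι : Type) [Fintype ι] (A : ι → MvPolynomial (Cell n) ℝ)
    (m : ι → (Cell n →₀ ℕ)) (S' : MvPolynomial (Cell n) ℝ) (C : Finset (Cell n)),
    IsPSD S' → (∀ k, ∃ c ∈ C, m k c ≠ 0) →
    (perR n ∣ (∑ k, A k ^ 2) + S' + ∑ k, monomial (m k) 1 * A k) →
    -- restriction to the coordinate section `x_C = 0`
    let kill : MvPolynomial (Cell n) ℝ →+* MvPolynomial (Cell n) ℝ :=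
      (MvPolynomial.aeval fun c => if c ∈ C then (0 : MvPolynomial (Cell n) ℝ) else X c).toRingHom
    Irreducible (kill (perR n)) →
    (∃ z : Cell n → ℝ, MvPolynomial.eval z (kill (perR n)) < 0) →   -- sign change survives
    ∀ k, kill (perR n) ∣ kill (A k)

/-- The C′-facing shape of Card A (squares at the top of a cheap multiple descend to a cheap
multiple of half the degree). NOTE the cofactor of `u t` need not be monotone — membership in the
ideal `(per_n)` over `ℝ` is what descends; see the card's caveat. -/
def SquareTopHalving : Prop :=
  ∀ n : ℕ, 2 ≤ n → ∀ (h : MvPolynomial (Cell n) NNReal) (ι : Type) [Fintype ι]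
    (u : ι → MvPolynomial (Cell n) NNReal) (E : ι → (Cell n →₀ ℕ)),
    h ≠ 0 → perN n * h = ∑ t, monomial (2 • E t) 1 * u t ^ 2 →
    ∀ t, perR n ∣ toR (u t)

/-! ## Card B — syntactic content stripping (JSS22 beyond monomials) -/

open ArithCircuit

variable {k : Type} [CommSemiring k] {σ : Type}

/-- Syntactic multiplicity of gate `γ` in an operand, given the multiplicities of earlier gates. -/
def opMult (γ : ℕ) (as : List ℕ) : Operand k σ → ℕ
  | .var _ => 0
  | .const _ => 0
  | .gate j => if j = γ then 1 else as.getD j 0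

/-- Syntactic multiplicity of gate `γ` in a gate: products add, (weighted) sums take the minimum
(empty sum `↦ 0`). -/
def gateMult (γ : ℕ) (as : List ℕ) : Gate k σ → ℕ
  | .prod args => (args.map (opMult γ as)).sum
  | .sum args => ((args.map fun a => opMult γ as a.2).minimum).getD 0

/-- Multiplicities of all gates (left fold, like `gateValues`). -/
def gateMults (γ : ℕ) (gs : List (Gate k σ)) : List ℕ :=
  gs.foldl (fun as g => as ++ [gateMult γ as g]) []

/-- Syntactic multiplicity of gate `γ` in the output of a circuit. -/
def synMult (γ : ℕ) (P : ArithCircuit k σ) : ℕ :=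
  opMult γ (gateMults γ P.gates) P.output

/-- B1 (gate-power stripping, the generalisation of JSS22 Lemma 2 from the greatest monomial factor to
powers of an arbitrary gate): the output factors as `q^a · P̃` with `q` the value of gate `γ`,
`a = synMult γ`, and `P̃` monotone of complexity `O(s²)` (carry `P̃_v`; at a sum gate multiply the
summands by `q^{Δ}`, `Δ ≤ 2^s`, from `s` repeated squarings of `q`). Over `ℝ≥0` no cancellation can
spoil the bookkeeping. -/
def GatePowerStripping : Prop :=
  ∃ Cst : ℕ, ∀ (n : ℕ) (P : ArithCircuit NNReal (Cell n)) (γ : ℕ), P.IsFanInTwo → γ < P.size →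
    ∃ Pt : MvPolynomial (Cell n) NNReal,
      P.eval = ((gateValues P.gates).getD γ 0) ^ (synMult γ P) * Pt ∧
      complexity Pt ≤ Cst * (P.size + 1) ^ 2

/-- JSS22 Theorem 1 + Lemma 2 in closed form, DEGREE-FREE (the tree's
`complexity_le_of_monomial_mul` pays `8^{deg D}`): dividing out a monomial of any degree costs
`O(n² · (s + n²·log deg)²)`. [JuknaSeiwertSergeev2022, Thm 1] -/
def MonomialStrippingDegreeFree : Prop :=
  ∃ Cst : ℕ, ∀ (n : ℕ) (D : Cell n →₀ ℕ) (q : MvPolynomial (Cell n) NNReal),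
    complexity q ≤ Cst * (n ^ 2 + 1) *
      (complexity (monomial D 1 * q) + (n ^ 2 + 1) * (Nat.log 2 (D.sum fun _ e => e) + 1)) ^ 2

/-- The C′-facing corollary of B1, IDEAL FORM: if some size-`s` circuit for `per_n · h` has a gate `γ` of value
`q` with `per ∤ q` and output multiplicity `a`, then the stripped output `G = per_n · h / q^a` is a MONOTONE polynomial,
a multiple of `per_n` over `ℝ`, of complexity `O(s²)` and degree `deg (per·h) − a · deg q`. (The real cofactor `h / q^a`
need not have nonnegative coefficients — see `ContentReductionLiteral` for the form C′ literally asks for.) -/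
def ContentReduction : Prop :=
  ∃ Cst : ℕ, ∀ (n : ℕ) (h : MvPolynomial (Cell n) NNReal) (P : ArithCircuit NNReal (Cell n)) (γ : ℕ),
    P.IsFanInTwo → γ < P.size → P.Computes (perN n * h) →
    ¬ (perR n ∣ toR ((gateValues P.gates).getD γ 0)) →
    ∃ G : MvPolynomial (Cell n) NNReal,
      perN n * h = ((gateValues P.gates).getD γ 0) ^ (synMult γ P) * G ∧
      (perR n ∣ toR G) ∧
      complexity G ≤ Cst * (P.size + 1) ^ 2

/-- LITERAL FORM for C′: whenever `h = q^b · h'` with `h'` monotone and `b ≤ a` (the largest such `b` is the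
monotone part of the content; `b = a` iff `h / q^a` is itself monotone), `per · h' = q^{a-b} · G` is cheap:
complexity `O(s²)`; the degree saving is `b · deg q`. -/
def ContentReductionLiteral : Prop :=
  ∃ Cst : ℕ, ∀ (n : ℕ) (h : MvPolynomial (Cell n) NNReal) (P : ArithCircuit NNReal (Cell n)) (γ : ℕ),
    P.IsFanInTwo → γ < P.size → P.Computes (perN n * h) →
    ¬ (perR n ∣ toR ((gateValues P.gates).getD γ 0)) →
    ∀ b ≤ synMult γ P, ∀ h' : MvPolynomial (Cell n) NNReal,
      h = ((gateValues P.gates).getD γ 0) ^ b * h' →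
      complexity (perN n * h') ≤ Cst * (P.size + 1) ^ 2

end

end Summit.ValiantsHypothesis.ValiantsHypothesis.Cruxes.PerCofactorDegreeReduction.Ideator1
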